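import Mathlib
import Summits.BirchSwinnertonDyer.BirchSwinnertonDyer.Theorems.ManinLocalTwoThreeThreeDvdModularDegree
import HarnessLib

/-!
# `2 ∣ deg φ_D` when `φ_D` is invariant under an Atkin–Lehner involution `w_Q` (`Q ∥ N`, `Q > 1`) — the involution twin of E-an-46

Summit `BirchSwinnertonDyer`, sub-problem `BirchSwinnertonDyer`, route `ManinLocalTwoThree`; width seat `bsd-line-manin23-p2`
(gen 9), `--supports` the crux C2 `ManinOddAtFour` (stmt-BirchSwinnertonDyer-22967).  Cell `bsd-f2-manin`, an lens (MEMO-an §60–§61,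
leaf `…ManinAdditive.OddDegreeTooth`, rows E-an-74/75 and the named implication `OddDegreeForcesQuarterSymbol`, «NOT kernel-proved:
the tree has no `w_Q`-functional equation for `φ`» — it has one now: `eichlerIntegral_atkinLehnerW_smul`).  Yazdani 2011 Lemma 2.4
(«if `φ₀(w_p ∞) = O` and `λ_p = +1` then `φ₀` factors through `X₀(4p)/w_p`, so `deg φ₀` is even») in the kernel, for ANY datum at
ANY level, by the fibre-counting method of the seat's gen-8 E-an-46 proof (`threeDvdModularDegreeOfCuspImageZero_holds`):

* `φ_atkinLehnerW_smul` — `w_Q f = f` and `φ_D([x/(N/Q)]) = O` (`x/(N/Q) = w(Q)∞`) ⟹ `φ_D(w(Q) z) = φ_D(z)` on `ℍ`;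
* `Y0_mk_atkinLehnerW_sq` — `[w(Q) w(Q) z] = [z]` in `Y₀(N)` (`w(Q)² = Q·γ₀`);
* `subsingleton_setOf_gamma_smul_eq_atkinLehnerW_smul`, `countable_setOf_exists_gamma_smul_eq_atkinLehnerW_smul` — for `Q > 1`
  the `w(Q)`-fixed `Γ₀(N)`-orbits are COUNTABLE (`γ z = w(Q) z` has at most one solution: `γ⁻¹w(Q)` scalar would force
  `N² = γ₁₀² Q`, `N ∣ γ₁₀`, i.e. `Q = 1`);
* **`two_dvd_modularDegree_of_atkinLehnerW_invariant`** — under the two hypotheses of the first bullet, `2 ∣ deg φ_D`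
  (on a generic fibre `w(Q)` is a fixed-point-free involution; `Equiv.Perm.card_fixedPoints_modEq`).

For the blind family at `N = 4p` this is the kernel half of E-an-75 ⟸ E-an-74 (`OddDegreeForcesQuarterSymbol`): the remaining input
is E-facing (`λ_p(f_{E′_m}) = +1`, non-split multiplicative reduction at `p`, and the cusp class `w(p)∞ ~ 1/4`).
BSD is not proved by this; Manin's conjecture is not proved by this.
-/

set_option autoImplicit false
set_option linter.dupNamespace false

noncomputable section

open scoped MatrixGroups ModularForm
open CongruenceSubgroup Matrix.SpecialLinearGroup UpperHalfPlane
open Literature.NumberTheory.EllipticCurves Literature.NumberTheory.EllipticCurves.ModularForms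
open Summit.BirchSwinnertonDyer.Rank1Residual.ManinAdditive

namespace Summit.BirchSwinnertonDyer.BirchSwinnertonDyer.Theorems.ManinLocalTwoThree

variable {N Q : ℕ} [NeZero N] [NeZero Q]

/-- **`φ_D ∘ w(Q) = φ_D`** when `w_Q f_D = f_D` and the cusp `w(Q)∞ = x/(N/Q)` maps to `O`
(`E_f(w(Q) z) = E_f(z) + {∞, x/(N/Q)}_f`, `eichlerIntegral_atkinLehnerW_smul`). -/
theorem φ_atkinLehnerW_smul (hQN : Q ∣ N) (hc : Nat.Coprime Q (N / Q)) {W : WeierstrassCurve ℚ} [W.IsElliptic]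
    (D : ModularParametrizationData W N) (hε : atkinLehnerInvolution N 2 Q D.f = D.f)
    (h0 : D.uniformize ((D.c : ℂ) * modularSymbol D.f ((atkinLehnerSL N Q 0 0 : ℚ) / (N / Q : ℕ))) = 0) (z : ℍ) :
    D.φ (glCast (atkinLehnerW N Q : GL (Fin 2) ℚ) • z) = D.φ z := by
  have hε' : atkinLehnerInvolution N 2 Q D.f = (1 : ℂ) • D.f := by rw [one_smul]; exact hε
  have hE := eichlerIntegral_atkinLehnerW_smul hQN hc hε' z
  simp only [ModularParametrizationData.φ]
  rw [hE, one_mul, mul_add, map_add, h0, add_zero]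

omit [NeZero N] in
/-- **`[w(Q) w(Q) z] = [z]` in `Y₀(N)`** (`w(Q)² = γ₀ · (Q·1)`, `γ₀ ∈ Γ₀(N)`; scalars act trivially). -/
theorem Y0_mk_atkinLehnerW_sq (hQN : Q ∣ N) (hc : Nat.Coprime Q (N / Q)) (z : ℍ) :
    Y0.mk N (glCast (atkinLehnerW N Q : GL (Fin 2) ℚ) • glCast (atkinLehnerW N Q : GL (Fin 2) ℚ) • z) = Y0.mk N z := by
  obtain ⟨γ₀, hγ₀, hsq⟩ := exists_atkinLehnerW_mul_self N Q hQN hc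
  rw [smul_smul, hsq, mul_smul, Y0.mk_eq_mk_iff]
  refine ⟨⟨γ₀, hγ₀⟩, ?_⟩
  change (mapGL ℝ γ₀ : GL (Fin 2) ℝ) • z = (mapGL ℝ γ₀ : GL (Fin 2) ℝ) • (tpD Q * tpG Q) • z
  have hQ : (0 : ℝ) < Q := by exact_mod_cast NeZero.pos Q
  have hdet : 0 < (tpD Q * tpG Q : GL (Fin 2) ℝ).det.val := by
    rw [map_mul, Units.val_mul]
    have h1 : 0 < (tpD Q : GL (Fin 2) ℝ).det.val := by
      rw [Matrix.GeneralLinearGroup.val_det_apply, val_tpD, Matrix.det_fin_two_of]; simp [hQ]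
    have h2 : 0 < (tpG Q : GL (Fin 2) ℝ).det.val := by
      rw [Matrix.GeneralLinearGroup.val_det_apply, val_tpG, Matrix.det_fin_two_of]; simp [hQ]
    exact mul_pos h1 h2
  have hval : ((tpD Q * tpG Q : GL (Fin 2) ℝ) : Matrix (Fin 2) (Fin 2) ℝ) = !![(Q : ℝ), 0; 0, Q] := by
    rw [Matrix.GeneralLinearGroup.coe_mul, val_tpD, val_tpG]
    ext i j
    fin_cases i <;> fin_cases j <;> simp [Matrix.mul_apply, Fin.sum_univ_two]
  have e10 : (tpD Q * tpG Q : GL (Fin 2) ℝ) 1 0 = 0 := by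
    show ((tpD Q * tpG Q : GL (Fin 2) ℝ) : Matrix (Fin 2) (Fin 2) ℝ) 1 0 = 0; rw [hval]; simp
  have e01 : (tpD Q * tpG Q : GL (Fin 2) ℝ) 0 1 = 0 := by
    show ((tpD Q * tpG Q : GL (Fin 2) ℝ) : Matrix (Fin 2) (Fin 2) ℝ) 0 1 = 0; rw [hval]; simp
  have e00 : (tpD Q * tpG Q : GL (Fin 2) ℝ) 0 0 = (tpD Q * tpG Q : GL (Fin 2) ℝ) 1 1 := by
    show ((tpD Q * tpG Q : GL (Fin 2) ℝ) : Matrix (Fin 2) (Fin 2) ℝ) 0 0 =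
      ((tpD Q * tpG Q : GL (Fin 2) ℝ) : Matrix (Fin 2) (Fin 2) ℝ) 1 1
    rw [hval]; simp
  rw [smul_eq_self_of_scalar hdet e10 e01 e00]

/-- **For `γ ∈ Γ₀(N)` and `Q > 1`, the equation `γ z = w(Q) z` has at most ONE solution in `ℍ`**: two solutions make
`γ⁻¹ w(Q) = a·1` scalar, and comparing `(1,0)` entries and determinants gives `N = γ₁₀ a`, `a² = Q`, so `N² = γ₁₀² Q` with
`N ∣ γ₁₀` — forcing `Q = 1`. -/
theorem subsingleton_setOf_gamma_smul_eq_atkinLehnerW_smul (hQN : Q ∣ N) (hc : Nat.Coprime Q (N / Q)) (hQ1 : Q ≠ 1)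
    (γ : Gamma0 N) :
    ({z : ℍ | γ • z = glCast (atkinLehnerW N Q : GL (Fin 2) ℚ) • z} : Set ℍ).Subsingleton := by
  set Wm : GL (Fin 2) ℝ := glCast (atkinLehnerW N Q : GL (Fin 2) ℚ) with hWm
  set G : GL (Fin 2) ℝ := (mapGL ℝ (γ : SL(2, ℤ)) : GL (Fin 2) ℝ) with hG
  set g : GL (Fin 2) ℝ := G⁻¹ * Wm with hg
  have hdetW : 0 < Wm.det.val := det_glCast_pos _
  have hdetG : G.det.val = 1 := det_mapGL_val γ
  have hdetg : 0 < g.det.val := by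
    rw [hg, map_mul, map_inv, Units.val_mul, Units.val_inv_eq_inv_val, hdetG, inv_one, one_mul]
    exact hdetW
  have hset : ∀ z : ℍ, γ • z = Wm • z ↔ g • z = z := by
    intro z
    change G • z = Wm • z ↔ (G⁻¹ * Wm) • z = z
    rw [mul_smul G⁻¹ Wm z, inv_smul_eq_iff, eq_comm]
  intro z₁ h₁ z₂ h₂
  by_contra hne
  rw [Set.mem_setOf_eq, hset] at h₁ h₂
  obtain ⟨hc0, hb, had⟩ := scalar_of_two_fixedPoints hdetg h₁ h₂ hne
  have hGg : G * g = Wm := by rw [hg, mul_inv_cancel_left]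
  have hent : ∀ i j, (Wm : Matrix (Fin 2) (Fin 2) ℝ) i j =
      ∑ k, (G : Matrix (Fin 2) (Fin 2) ℝ) i k * (g : Matrix (Fin 2) (Fin 2) ℝ) k j := by
    intro i j
    rw [← hGg, Matrix.GeneralLinearGroup.coe_mul, Matrix.mul_apply]
  have h10 := hent 1 0
  rw [Fin.sum_univ_two] at h10
  have hW10 : (Wm : Matrix (Fin 2) (Fin 2) ℝ) 1 0 = N := by
    rw [hWm, val_glCast_atkinLehnerW N Q hQN hc]; simp
  have hG10 : (G : Matrix (Fin 2) (Fin 2) ℝ) 1 0 = (((γ : SL(2, ℤ)) 1 0 : ℤ) : ℝ) := by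
    rw [hG, val_mapGL']; simp
  have hG11g : (G : Matrix (Fin 2) (Fin 2) ℝ) 1 1 * (g : Matrix (Fin 2) (Fin 2) ℝ) 1 0 = 0 := by
    rw [show (g : Matrix (Fin 2) (Fin 2) ℝ) 1 0 = g 1 0 from rfl, hc0, mul_zero]
  rw [hW10, hG10, hG11g, add_zero] at h10
  -- determinants: `det w(Q) = Q = det G · det g = a²`
  have hdetQ : Wm.det.val = Q := by
    rw [hWm]; exact det_glCast_atkinLehnerW N Q
  have hdetprod : Wm.det.val = G.det.val * g.det.val := by rw [← hGg, map_mul, Units.val_mul]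
  have hdetg' : g.det.val = g 0 0 * g 0 0 := by
    rw [Matrix.GeneralLinearGroup.val_det_apply, Matrix.det_fin_two]
    rw [show (g : Matrix (Fin 2) (Fin 2) ℝ) 1 0 = g 1 0 from rfl, show (g : Matrix (Fin 2) (Fin 2) ℝ) 0 1 = g 0 1 from rfl,
      show (g : Matrix (Fin 2) (Fin 2) ℝ) 1 1 = g 1 1 from rfl, show (g : Matrix (Fin 2) (Fin 2) ℝ) 0 0 = g 0 0 from rfl,
      hc0, hb, ← had]
    ring
  rw [hdetprod, hdetG, one_mul, hdetg'] at hdetQ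
  set a : ℝ := g 0 0 with ha
  set c : ℤ := (γ : SL(2, ℤ)) 1 0 with hcdef
  -- `N = c a`, `a² = Q` ⟹ `N² = c² Q`
  have hsq : ((N : ℝ)) ^ 2 = ((c : ℝ)) ^ 2 * Q := by
    have e : (N : ℝ) = (c : ℝ) * a := by
      rw [h10]
    rw [e, mul_pow, ← hdetQ]; ring
  have hsqZ : ((N : ℤ)) ^ 2 = c ^ 2 * Q := by exact_mod_cast hsq
  -- `N ∣ c`
  have hdvd : ((N : ℕ) : ℤ) ∣ c := (ZMod.intCast_zmod_eq_zero_iff_dvd c N).mp (Gamma0_mem.mp γ.2)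
  obtain ⟨k, hk⟩ := hdvd
  have hNpos : (0 : ℤ) < N := by exact_mod_cast NeZero.pos N
  rw [hk] at hsqZ
  have h1 : k ^ 2 * (Q : ℤ) = 1 := by
    have hN2 : ((N : ℤ)) ^ 2 ≠ 0 := pow_ne_zero 2 hNpos.ne'
    have : ((N : ℤ)) ^ 2 * (k ^ 2 * Q) = ((N : ℤ)) ^ 2 * 1 := by linear_combination -hsqZ
    exact mul_left_cancel₀ hN2 this
  have hk2 : 0 ≤ k ^ 2 := sq_nonneg k
  have hk1 : k ^ 2 = 1 := Int.eq_one_of_mul_eq_one_right hk2 h1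
  have hQ1' : (Q : ℤ) = 1 := by rw [hk1, one_mul] at h1; exact h1
  exact hQ1 (by exact_mod_cast hQ1')

/-- **The `w(Q)`-fixed `Γ₀(N)`-orbits form a COUNTABLE subset of `ℍ`** (`Q > 1`). -/
theorem countable_setOf_exists_gamma_smul_eq_atkinLehnerW_smul (hQN : Q ∣ N) (hc : Nat.Coprime Q (N / Q)) (hQ1 : Q ≠ 1) :
    ({z : ℍ | ∃ γ : Gamma0 N, γ • z = glCast (atkinLehnerW N Q : GL (Fin 2) ℚ) • z} : Set ℍ).Countable := by
  haveI : Countable SL(2, ℤ) := countable_SL2Z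
  have hunion : ({z : ℍ | ∃ γ : Gamma0 N, γ • z = glCast (atkinLehnerW N Q : GL (Fin 2) ℚ) • z} : Set ℍ) =
      ⋃ γ : Gamma0 N, {z : ℍ | γ • z = glCast (atkinLehnerW N Q : GL (Fin 2) ℚ) • z} := by
    ext z; simp only [Set.mem_setOf_eq, Set.mem_iUnion]
  rw [hunion]
  exact Set.countable_iUnion fun γ => (subsingleton_setOf_gamma_smul_eq_atkinLehnerW_smul hQN hc hQ1 γ).countable

/-- **`2 ∣ deg φ_D` for a `w(Q)`-invariant parametrisation** (`Q ∥ N`, `Q > 1`; hypotheses: `w_Q f_D = f_D` and the cusp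
`w(Q)∞ = x/(N/Q)` maps to `O`).  Fibre counting: on a fibre over a point `P` avoiding the countable image of the `w(Q)`-fixed orbits
and the finite exceptional set of `deg_spec`, `y ↦ w(Q)y` is a fixed-point-free involution, so the fibre has even cardinality. -/
theorem two_dvd_modularDegree_of_atkinLehnerW_invariant (hQN : Q ∣ N) (hc : Nat.Coprime Q (N / Q)) (hQ1 : Q ≠ 1)
    {W : WeierstrassCurve ℚ} [W.IsElliptic] (D : ModularParametrizationData W N)
    (hε : atkinLehnerInvolution N 2 Q D.f = D.f)
    (h0 : D.uniformize ((D.c : ℂ) * modularSymbol D.f ((atkinLehnerSL N Q 0 0 : ℚ) / (N / Q : ℕ))) = 0) :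
    2 ∣ D.modularDegree := by
  classical
  set Wm : GL (Fin 2) ℝ := glCast (atkinLehnerW N Q : GL (Fin 2) ℚ) with hWm
  set F : Set ℍ := {z : ℍ | ∃ γ : Gamma0 N, γ • z = Wm • z} with hF
  have hFc : F.Countable := countable_setOf_exists_gamma_smul_eq_atkinLehnerW_smul hQN hc hQ1
  set Bad : Set (W.baseChange ℂ).toAffine.Point := {P | D.fiberOrbitCount P ≠ D.modularDegree} ∪ D.φ '' F with hBad
  have hBadc : Bad.Countable := D.finite_setOf_fiberOrbitCount_ne.countable.union (hFc.image _)
  obtain ⟨P, hP⟩ : ∃ P, P ∉ Bad := by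
    by_contra hall
    simp only [not_exists, not_not] at hall
    exact not_countable_univ_points D (hBadc.mono fun P _ => hall P)
  have hcount : D.fiberOrbitCount P = D.modularDegree := by
    by_contra h
    exact hP (Or.inl h)
  have hPF : ∀ z : ℍ, D.φ z = P → z ∉ F := fun z hz hzF => hP (Or.inr ⟨z, hzF, hz⟩)
  set S := {y : Y0 N // ∃ τ : ℍ, Y0.mk N τ = y ∧ D.φ τ = P} with hS
  have hcardS : Nat.card S = D.modularDegree := hcount
  haveI : Finite S := Nat.finite_of_card_ne_zero (by rw [hcardS]; exact D.deg_pos.ne')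
  letI : Fintype S := Fintype.ofFinite S
  have hnorm : ∀ x ∈ (Gamma0 N : Subgroup (GL (Fin 2) ℝ)), Wm * x * Wm⁻¹ ∈ (Gamma0 N : Subgroup (GL (Fin 2) ℝ)) :=
    fun x hx => atkinLehnerW_mul_mul_inv_mem N Q hQN hc hx
  have hinv : ∀ z : ℍ, D.φ (Wm • z) = D.φ z := φ_atkinLehnerW_smul hQN hc D hε h0
  let σ : Function.End S := fun y =>
    ⟨Y0.mk N (Wm • y.2.choose), Wm • y.2.choose, rfl, by rw [hinv]; exact y.2.choose_spec.2⟩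
  have hσ : ∀ (y : S) (τ : ℍ), Y0.mk N τ = y.1 → (σ y).1 = Y0.mk N (Wm • τ) := by
    intro y τ hτ
    show Y0.mk N (Wm • y.2.choose) = Y0.mk N (Wm • τ)
    exact Y0_mk_smul_eq_of_mk_eq hnorm (y.2.choose_spec.1.trans hτ.symm)
  -- `σ² = 1`
  have hσ2 : σ ^ 2 ^ 1 = 1 := by
    rw [pow_one]
    funext y
    obtain ⟨τ, hτ, -⟩ := y.2
    have h1 := hσ y τ hτ
    have h2 := hσ (σ y) (Wm • τ) h1.symm
    apply Subtype.ext
    show (σ (σ y)).1 = y.1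
    rw [h2, Y0_mk_atkinLehnerW_sq hQN hc τ, hτ]
  haveI : IsEmpty (Function.fixedPoints σ) := by
    refine ⟨fun ⟨y, hy⟩ => ?_⟩
    obtain ⟨τ, hτ, hφ⟩ := y.2
    have h1 := hσ y τ hτ
    rw [Function.mem_fixedPoints_iff] at hy
    rw [hy] at h1
    obtain ⟨γ, hγ⟩ := (Y0.mk_eq_mk_iff N _ _).mp (hτ.trans h1).symm
    exact hPF τ hφ ⟨γ, hγ⟩
  haveI : Fact (Nat.Prime 2) := ⟨Nat.prime_two⟩
  have hmod := Equiv.Perm.card_fixedPoints_modEq (p := 2) (n := 1) hσ2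
  rw [Fintype.card_eq_zero (α := ↥(Function.fixedPoints σ)), Nat.ModEq, Nat.zero_mod] at hmod
  change 2 ∣ D.modularDegree
  rw [← hcardS, Nat.card_eq_fintype_card]
  exact Nat.dvd_of_mod_eq_zero hmod

end Summit.BirchSwinnertonDyer.BirchSwinnertonDyer.Theorems.ManinLocalTwoThree

end
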